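import Summits.KontsevichZagierPeriods.KontsevichZagierPeriods.Theses.IsogenyCertificates
import Literature.NumberTheory.Transcendental.KZKernelConjectureForms
import Literature.NumberTheory.Transcendental.KZSubcalculusInvariants

/-!
# Disproof of `GenusTwoRealPeriodCell` (stmt-KontsevichZagierPeriods-17657) — standing disprover's work file

Crux (route IsogenyCertificates, rank 7): Conjecture 1 of Kontsevich–Zagier in KERNEL FORM on the
sector of real half-periods of genus-2 curves over `ℚ` — every value-`0` element of the subgroup of
`KZ.FormalRep` generated by `[K, (a₀+a₁x)/√F]` (`F ∈ ℚ[X]` squarefree, `natDegree F ∈ {5,6}`,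
`K` = component of `{F>0}` through a rational `q` with `F(q) > 0`, `a₀ a₁ ∈ ℚ`) lies in
`KZ.relations`.

VERDICT OF CYCLE 1: **no kill; no kill is possible short of refuting the formalised summit.**

## Findings (all kernel-checked unless marked NEAR-MISS / OPEN)

* **F1 (strength).** `KontsevichZagierPeriods → GenusTwoRealPeriodCell` (`of_summit` below; tree:
  `kzKernelConjecture_iff_isRational`). Hence `¬ crux → ¬ summit` (`not_summit_of_not`): there is no
  `refuted-misstated` outcome for this item, and a counterexample would be a counterexample to the
  Kontsevich–Zagier period conjecture as formalised (`Literature.Periods.KZPeriodConjecture`).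
* **F2 (load-bearing analysis of the SECTOR hypotheses).** For EVERY generating set `T`, the cell
  `∀ c ∈ closure T, eval c = 0 → c ∈ relations` follows from the summit (`cellOfSector_of_summit`).
  So dropping `Squarefree F` (`withoutSquarefree_of_summit`), the degree window
  (`withoutDegree_of_summit`), `0 < F(q)` (`withoutPositivity_of_summit`), or allowing real-algebraic
  `F, q, a₀, a₁` (`algebraicCoefficients_of_summit`) NEVER produces a false statement: these
  hypotheses are not load-bearing for truth — no `_false_without_<H>` theorem can exist for them
  (each would be `¬ summit`). What they ARE load-bearing for is the METHOD: `Squarefree` keeps the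
  weight/genus pure (with `F = G²H`, `deg H ≤ 2`, the sector would contain `π` and logarithms;
  `deg H ∈ {3,4}` elliptic periods); the degree window fixes genus 2 and the first-kind forms
  `dx/y, x dx/y`; `0 < F(q)` only excludes the EMPTY component (a null-domain representation, itself a
  relation, `KZ.of_mem_relations_of_volume_eq_zero`); `q ∈ ℚ` is no restriction at all (every
  component of `{F>0}` is an open interval and contains a rational).
* **F3 (the one load-bearing hypothesis).** `eval c = 0` is load-bearing: the generating set is not
  inside `KZ.relations ≤ ker eval` (honest generator `[ℝ, 1/√(x⁶+1)]` of positive value).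
  LANDED as `GenusTwoRealPeriodCell.Negative.false_without_eval` (p144958, `Negative/Witnesses.lean`).
* **F4 (parity law; a natural strengthening REFUTED).** For even `F` the generator through `q = 0`
  with `a₀ = 0` has value `0` (`Negative.value_eq_zero_of_even`, from the general
  `Negative.value_eq_zero_of_odd`: Lebesgue measure on `ℝⁿ` is negation invariant). Hence GENERATOR
  NON-DEGENERACY — "a sector generator of value 0 has `a₀ = a₁ = 0`", true in the genus-ONE real-period
  cell where `a/√P` has a sign and used there as the first step (independence ⇒ orbit collapse) —
  FAILS in genus two: `Negative.not_generator_nondegenerate`, witness `[ℝ, x/√(x⁶+1)]` (p144958).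
  Lesson for provers: the kernel of `eval` on this sector contains ONE-TERM elements; any
  normal-form / independence argument must first quotient by the bielliptic parity `x ↦ −x`
  (more generally by every rational Möbius involution preserving `F` up to squares), exactly the
  "formal a₁-cancellation" of the sibling crux 18685.
  ADDENDUM (theory, checked numerically in the census; not yet in Lean beyond parity). (i) The sector
  is closed under the whole group `PGL₂(ℚ)` acting on binary sextic forms (Möbius models:
  `F ↦ (cx+d)⁶F(m x)`, `K ↦ m⁻¹K`, `(a₀+a₁x)dx/y ↦ ±det m·(cx+d)·(…)dx/y'` — one generator to one
  generator whenever the pole `−d/c ∉ m⁻¹K`), so the natural normal-form group of any proof is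
  `PGL₂(ℚ)`, not the affine group. (ii) A rational involution `m` with `F∘m ∝ F` acts on
  `⟨dx/y, x dx/y⟩` by `(det m/√u)·[[d,c],[b,a]]`, eigenvalues `±√(−det m)`: its anti-invariant
  form is RATIONAL iff `−det m ∈ ℚ²` iff `m` is `PGL₂(ℚ)`-conjugate to `x ↦ −x`; every such `m` with an
  `m`-stable component `K` gives a one-term kernel element `[K, ω₋]` (e.g. palindromic `F`,
  `m = 1/x`, `K ∋ 1`: `∫_K (1−x)dx/√F = 0`), and all of these are `PGL₂(ℚ)`-conjugate to the parity
  element of `value_eq_zero_of_even`; involutions with `−det m ∉ ℚ²` (e.g. `x ↦ 2/x` on `x⁶+8`) have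
  irrational eigenforms and produce NO kernel element of this `ℚ`-sector. (iii) One-term kernel
  elements NOT from involutions exist: Kuhn's `(3,3)`-split normal form
  `F = (x³+ax²+bx+c)(4cx³+b²x²+2bcx+c²)` at `(a,b,c) = (0,−7,6), (−2,−5,6), (0,−13,12)` has
  `∫_B x dx/√F = 0` on its bounded component (ideator kit j023044; a null push-forward cycle). The
  complete list is Wüstholz's vanishing criterion: `∫_γ ω = 0` iff `ω` vanishes on the smallest
  abelian subvariety (sub-1-motive) whose `H₁` contains `γ` — so one-term kernel elements occur
  EXACTLY on non-simple Jacobians / degenerate 1-motives, for every splitting degree `n`, and their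
  certificates are the degree-`n` covering transfers (n = 2: split–flip–cancel by rules 1a, 2, 1b).
* **F5 (sub-calculi).** Every certificate of the parity relation `[ℝ, x/√(x⁶+1)] ∈ relations` uses
  an ADDITIVITY move (`Negative.false_without_additivity`, invariant `KZ.coeffSum`) and a
  CHANGE-OF-VARIABLES-or-NEWTON–LEIBNIZ move (`Negative.false_without_cov_nl`, invariant
  `KZ.restrictedEval` on `{x₀ > 0}`); the obvious certificate (split at `0`, flip `x ↦ −x`, cancel by
  1b, null/zero representation) uses (1a), (2), (1b) and NO Newton–Leibniz. The same two invariants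
  show that the 3-term Cauchy relation `[r₀₁] − [r₂₃] + [r₅]` on `y² = x(x−1)(x−2)(x−3)(x−5)`
  (landed: `HermiteRigidity.GenusTwoCycleTransfer_proof`, certified WITH a Green/Newton–Leibniz step
  on a semialgebraic lens) needs additivity (coefficient sum `1`) and a (2)-or-(3) move
  (`restrictedEval` on `{x₀ < 1}` is `value r₀₁ > 0`). OPEN (recorded, not claimed):
  whether the Cauchy relation is a SCISSORS relation (rules 1a, 1b, 2 only, no Stokes) — no invariant
  of the scissors sub-calculus separating connected-domain elements of `ker eval` in dimension 1 is
  known: the Euler-weighted evaluations `J_g [σ,f] = g(E σ)·∫_σ f` of the tree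
  (`XMapKernel/Negative/EulerWeightedEval.lean`, rules 1b, 2, 3) restrict to `g(−1)·eval` on
  intervals (`E = −1` for every open interval, ray and line), so they vanish on every element of
  this sector's kernel. See `CauchyRelationIsScissors` below.
* **F6 (monotonicity).** `GenusTwoRealPeriodCell → BiellipticRealPeriodCell` (stmt-18685), landed
  contrapositively as `Negative.not_of_not_bielliptic` (p144905): the bielliptic generators are
  sector generators (`natDegree (G.comp X²) = 3·2`). A disprover of the EASIER sibling also kills
  this crux; conversely nothing is gained here by attacking 18685-shaped instances, all of which are
  reachable by the booked elliptic cells (route text).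
* **F7 (shape of any refutation).** `¬ crux ↔ ∃ c ∈ closure genSet, eval c = 0 ∧ c ∉ relations`
  `↔` an additive invariant `ψ : FormalRep →+ G` killing the four move sets with `ψ c ≠ 0`
  (`Negative.not_of_separating_invariant`, complete by `Negative.exists_separating_invariant_of_not`,
  p144905). NO such invariant finer than `eval` is known for the FULL calculus (for sub-calculi:
  `coeffSum`, `restrictedEval`, dimension-graded `eval`, Euler-weighted `J_g` — each killed by the
  missing rule). This is the meta-barrier of every `cdisprove` seat on this summit.
* **F8 (transcendence side is a THEOREM — no "unexpected relation" can exist).** Every real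
  half-period of the sector is a 1-period of curve type `(C, D)` (C the affine genus-2 curve,
  `D` = Weierstrass end points, or `∞±` for unbounded sextic components: periods of the 1-motive
  `[ℤ → J]`, `1 ↦ [∞⁺ − ∞⁻]`). Huber–Wüstholz 2022, Theorem 13.3 (p. 121; = Thm 9.10 for 1-motives,
  READ this cycle): "All relations between periods of curve type are induced by bilinearity and
  functoriality of pairs `(C,D) → (C′,D′)`". So the `ℚ`-relations inside the sector are EXACTLY the
  motivic ones (Hom(J,J′) incl. Richelot/(n,n)/split/RM/modular correspondences; oval dependences in
  `H₁`; torsion/dependence of `[∞⁺−∞⁻]` and of `[P − ιP]` classes — the ideators' kit jobs j023044 /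
  j022959 see precisely these: Cauchy relations, the torsion relation `3U₋ − 2B₁ + B₂ = 0` on
  `(x³−4x+1)² − 1` for both forms, two RM-over-ℚ relations on `X₀(23)`, none on the `√5`-curve with RM
  not over `ℚ`). A kill would therefore have to be a MOTIVIC relation with NO move chain, i.e. a
  separation of Nori's presentation of 1-periods from Kontsevich–Zagier's three-rules presentation
  in degree 1 (HW Remark 13.2(2) → HMS17 Remark 13.1.8 for the comparison of the two formulations) —
  for which no tool exists (F7). Kill criterion (4) of the route ("a lindep relation not explained by
  Hom ⊗ ℝ, ovals or torsion at ∞±") cannot fire if Theorem 13.3 is read correctly; the census jobs are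
  sanity checks of the READING, and they pass. THIS CYCLE'S CENSUS (kit j023501 + j023502, script
  `census/main.py`, evidence `census_summary.md`): ALL 39 514 squarefree quintics/sextics with
  coefficients in `[−2,2]` (mod `x ↦ −x`) plus 3000 random ones in `[−3,3]` and the curated curves —
  real half-periods `I₀, I₁` over every component to 50 digits, PSLQ lattice of `ℤ`-relations
  (`|coeff| ≤ 200`, tol `10⁻³⁰`) against the topological expectation "2 relations iff all roots real":
  0 errors, 0 unstable (50 vs 80 digits), **0 curves with FEWER relations** (the oval/Cauchy relation
  appears exactly on M-curves), 536 with EXTRA relations, every one motivic — 515 carry a rational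
  Möbius symmetry of `F` (involution/automorphism type, F4), the curated modular curves show the two
  RM-over-`ℚ` cross-form relations each (JL pair: `I₀(K₀) − I₀(K₁) − I₁(K₁) = 0`,
  `3I₀(K₀) + 4I₁(K₀) − I₀(K₁) = 0` on `f_X`; X₀(23)), and the remaining 14 are PELL sextics (continued
  fraction of `√F` quasi-periodic: `[∞⁺−∞⁻]` torsion of order 3, 4, 5; e.g. `(x³−x+1)²−1`:
  `2U₋ − B + U₊ = 0` for both forms; `x⁶+2x³−x = [0,−1,0,2,0,0,1]`: `3U₋ − 2B + 2U₊ = 0`). No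
  unexplained relation; the table is the test-suite any certificate engine for this crux must pass
  (involution moves; Hecke/RM correspondences; Abel/Pell traces of orders 3–5).
* **F9 (elaboration / junk audit, confirming the rattack stamp).** rc 0; `Real.sqrt` only meets
  `F > 0` on the domain; `connectedComponentIn … q` with `0 < F(q)` is a non-empty open interval
  (bounded: ends are simple roots, `x^{-1/2}` singularities, integrable; unbounded: decay `|x|^{-3/2}`
  (deg 5) / `|x|^{-2}`, `|x|^{-3}` (deg 6)), so honest `IntegralRep`s exist for every admissible
  `(F,q,a₀,a₁)` (instances in tree: `GenusTwoCycleTransferNegative.exists_rep*`, and p144958's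
  `exists_rep` on `x⁶+1` where `{F>0} = ℝ`); `a₀ = a₁ = 0` generators are relations (zero integrand);
  `Squarefree` over `ℚ` = separable = squarefree over `ℝ`. Frame: the family is closed under rational
  affine moves `x ↦ ux+v` and `F ↦ λ²F`; NOT closed under `x ↦ 1/(x−q)` within degree 5 (a quintic
  goes to a sextic and back only for rational Weierstrass points) — harmless, both degrees are in.

## Targets
None yet (no line picked, `stuck_stubs = []`). On re-arm: read the lead's HANDOFF `STUCK` list.

## Next regimes (cycle 2, if granted)
(a) import the landed `Negative/*` here and add the Cauchy-element versions of F5 (needs the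
component computations `connectedComponentIn {f>0} (1/2) = (0,1)` etc., ~80 lines, reusing
`GenusTwoCycleTransferNegative.exists_rep*`); (b) the involution census: classify rational Möbius
involutions `σ` with `F∘σ = F·(unit)²` — each gives one-term kernel elements `[K, ω_σ⁻]` beyond
parity (conjugacy classes of involutions in `PGL₂(ℚ)` ↔ `ℚ×/ℚ×²`; only the class of `x ↦ −x` acts
with a RATIONAL eigenform ratio?) and decide whether F4's list of one-term kernel elements is
complete (HW: `∫_γ ω = 0` iff `ω` vanishes on the smallest abelian subvariety containing `γ`);
(c) one batched kit job: lindep census over all squarefree quintics/sextics with coefficients in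
`{−2,…,2}` flagging curves whose `ℚ`-relation rank among real half-periods exceeds the oval count,
each flag to be explained by split Jacobian / RM over `ℚ` / Pell torsion — a test-suite for the
eventual certificate engine and a check of the reading of HW 13.3 (kill criterion 4).
-/

noncomputable section

set_option linter.dupNamespace false

namespace Summit.KontsevichZagierPeriods.KontsevichZagierPeriods.Cruxes.GenusTwoRealPeriodCell.Disproof

open Literature.NumberTheory.Transcendental
open Summit.KontsevichZagierPeriods.KontsevichZagierPeriods.Theses.IsogenyCertificates
open Set Polynomial

/-! ### F1 — strength: the crux is a corollary of the summit -/

/-- The kernel-form cell of an ARBITRARY sector `T ⊆ FormalRep`. -/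
def CellOfSector (T : Set KZ.FormalRep) : Prop :=
  ∀ c ∈ AddSubgroup.closure T, KZ.eval c = 0 → c ∈ KZ.relations

/-- Every sector cell follows from the kernel conjecture (hence from the summit). [folklore] -/
theorem cellOfSector_of_kzKernelConjecture (T : Set KZ.FormalRep) (hK : KZKernelConjecture) :
    CellOfSector T := fun c _ hc => hK c hc

/-- Every sector cell follows from the summit (tree: `kzKernelConjecture_iff_isRational`).
[cite: KontsevichZagier2001, §1.2 Conjecture 1] -/
theorem cellOfSector_of_summit (T : Set KZ.FormalRep) (hs : _root_.KontsevichZagierPeriods) :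
    CellOfSector T :=
  cellOfSector_of_kzKernelConjecture T
    ((KontsevichZagierPeriods_iff.trans kzKernelConjecture_iff_isRational.symm).1 hs)

/-- **F1.** The summit implies the crux. [cite: KontsevichZagier2001, §1.2 Conjecture 1] -/
theorem of_summit (hs : _root_.KontsevichZagierPeriods) : GenusTwoRealPeriodCell :=
  cellOfSector_of_summit _ hs

/-- **F1, contrapositive.** A kill of the crux is a kill of the formalised summit. [folklore] -/
theorem not_summit_of_not (h : ¬ GenusTwoRealPeriodCell) : ¬ _root_.KontsevichZagierPeriods :=
  fun hs => h (of_summit hs)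

/-! ### F2 — the sector hypotheses are not load-bearing for truth -/

/-- The crux with `Squarefree F` DROPPED. -/
def WithoutSquarefree : Prop :=
  CellOfSector {d | ∃ (F : Polynomial ℚ) (q a₀ a₁ : ℚ) (r : KZ.IntegralRep 1),
    (F.natDegree = 5 ∨ F.natDegree = 6) ∧ 0 < Polynomial.aeval (q : ℝ) F ∧
    r.domain = {x | x 0 ∈ connectedComponentIn {y : ℝ | 0 < Polynomial.aeval y F} (q : ℝ)} ∧
    Set.EqOn r.integrand
      (fun x => ((a₀ : ℝ) + (a₁ : ℝ) * x 0) / Real.sqrt (Polynomial.aeval (x 0) F)) r.domain ∧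
    d = KZ.of r}

/-- The crux with the degree window DROPPED (any degree: `π` for `deg 2`, elliptic periods for
`deg 3, 4`, hyperelliptic first-two-forms periods for `deg ≥ 7`). -/
def WithoutDegree : Prop :=
  CellOfSector {d | ∃ (F : Polynomial ℚ) (q a₀ a₁ : ℚ) (r : KZ.IntegralRep 1),
    Squarefree F ∧ 0 < Polynomial.aeval (q : ℝ) F ∧
    r.domain = {x | x 0 ∈ connectedComponentIn {y : ℝ | 0 < Polynomial.aeval y F} (q : ℝ)} ∧
    Set.EqOn r.integrand
      (fun x => ((a₀ : ℝ) + (a₁ : ℝ) * x 0) / Real.sqrt (Polynomial.aeval (x 0) F)) r.domain ∧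
    d = KZ.of r}

/-- The crux with `0 < F(q)` DROPPED (adds only empty-domain representations). -/
def WithoutPositivity : Prop :=
  CellOfSector {d | ∃ (F : Polynomial ℚ) (q a₀ a₁ : ℚ) (r : KZ.IntegralRep 1),
    Squarefree F ∧ (F.natDegree = 5 ∨ F.natDegree = 6) ∧
    r.domain = {x | x 0 ∈ connectedComponentIn {y : ℝ | 0 < Polynomial.aeval y F} (q : ℝ)} ∧
    Set.EqOn r.integrand
      (fun x => ((a₀ : ℝ) + (a₁ : ℝ) * x 0) / Real.sqrt (Polynomial.aeval (x 0) F)) r.domain ∧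
    d = KZ.of r}

/-- The crux ENLARGED to real-algebraic data: `F ∈ ℝ[X]` with algebraic coefficients, algebraic
base point and algebraic `a₀, a₁` (the genus-two analogue of `AlgebraicModuliRealPeriodCell`). -/
def AlgebraicCoefficients : Prop :=
  CellOfSector {d | ∃ (F : Polynomial ℝ) (q a₀ a₁ : ℝ) (r : KZ.IntegralRep 1),
    (∀ i, IsAlgebraic ℚ (F.coeff i)) ∧ IsAlgebraic ℚ q ∧ IsAlgebraic ℚ a₀ ∧ IsAlgebraic ℚ a₁ ∧
    Squarefree F ∧ (F.natDegree = 5 ∨ F.natDegree = 6) ∧ 0 < F.eval q ∧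
    r.domain = {x | x 0 ∈ connectedComponentIn {y : ℝ | 0 < F.eval y} q} ∧
    Set.EqOn r.integrand (fun x => (a₀ + a₁ * x 0) / Real.sqrt (F.eval (x 0))) r.domain ∧
    d = KZ.of r}

/-- **F2.** `Squarefree` is not load-bearing for truth. [folklore] -/
theorem withoutSquarefree_of_summit (hs : _root_.KontsevichZagierPeriods) : WithoutSquarefree :=
  cellOfSector_of_summit _ hs

/-- **F2.** The degree window is not load-bearing for truth. [folklore] -/
theorem withoutDegree_of_summit (hs : _root_.KontsevichZagierPeriods) : WithoutDegree :=
  cellOfSector_of_summit _ hs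

/-- **F2.** `0 < F(q)` is not load-bearing for truth. [folklore] -/
theorem withoutPositivity_of_summit (hs : _root_.KontsevichZagierPeriods) : WithoutPositivity :=
  cellOfSector_of_summit _ hs

/-- **F2.** Rationality of the data is not load-bearing for truth. [folklore] -/
theorem algebraicCoefficients_of_summit (hs : _root_.KontsevichZagierPeriods) :
    AlgebraicCoefficients :=
  cellOfSector_of_summit _ hs

/-! ### F5 — sub-calculi: what the landed invariants say, and the open scissors question -/

/-- OPEN QUESTION (recorded, NOT claimed either way): is the Cauchy oval relation of
`y² = x(x−1)(x−2)(x−3)(x−5)` a SCISSORS relation, i.e. certifiable by rules (1a), (1b), (2) without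
Newton–Leibniz/Stokes? The landed certificate (`GenusTwoCycleTransfer_proof`) uses Green's formula
on a semialgebraic lens. Obstruction to deciding it negatively: no invariant of the scissors
sub-calculus is known that is non-zero on a dimension-1 element of `ker eval` with interval domains
(Euler-weighted evaluations degenerate to `g(−1)·eval` there). Obstruction to deciding it positively:
a scissors certificate would be a real-algebraic "scissors congruence" of the three half-periods,
e.g. a chain of Richelot correspondences (rules 1, 2 only) closing up on the same curve — none found. -/
def CauchyRelationIsScissors : Prop :=
  ∀ (r₁ r₂ r₃ : KZ.IntegralRep 1),
    r₁.domain = {p | 0 < p 0 ∧ p 0 < 1} → r₂.domain = {p | 2 < p 0 ∧ p 0 < 3} →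
    r₃.domain = {p | 5 < p 0} →
    (∀ r ∈ [r₁, r₂, r₃], Set.EqOn r.integrand
      (fun p => 1 / Real.sqrt (p 0 * (p 0 - 1) * (p 0 - 2) * (p 0 - 3) * (p 0 - 5))) r.domain) →
    KZ.of r₁ - KZ.of r₂ + KZ.of r₃ ∈
      AddSubgroup.closure (KZ.domainAddRel ∪ KZ.integrandAddRel ∪ KZ.changeOfVariablesRel)

/-- **F5 (scissors moves have coefficient sum in `{0, −1}`-span; (2)+(3) alone preserve it).**
Re-export of the tree invariant used by `Negative.false_without_additivity`: a combination with
coefficient sum `≠ 0` — every one-term kernel element `[K, x/√F]` (`F` even) and every Cauchy triple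
`[r₁] − [r₂] + [r₃]` — is not in the subgroup generated by change of variables and Newton–Leibniz.
[cite: KontsevichZagier2001, §1.2] -/
theorem not_mem_closure_cov_nl_of_coeffSum_ne_zero {c : KZ.FormalRep} (hc : KZ.coeffSum c ≠ 0) :
    c ∉ AddSubgroup.closure (KZ.changeOfVariablesRel ∪ KZ.newtonLeibnizRel) := fun h =>
  hc (KZ.closure_cov_nl_le_ker_coeffSum h)

/-- The Cauchy triple has coefficient sum `1`, so its certificate uses an additivity move.
[cite: KontsevichZagier2001, §1.2] -/
theorem cauchyTriple_not_mem_closure_cov_nl (r₁ r₂ r₃ : KZ.IntegralRep 1) :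
    KZ.of r₁ - KZ.of r₂ + KZ.of r₃ ∉
      AddSubgroup.closure (KZ.changeOfVariablesRel ∪ KZ.newtonLeibnizRel) :=
  not_mem_closure_cov_nl_of_coeffSum_ne_zero (by simp)

end Summit.KontsevichZagierPeriods.KontsevichZagierPeriods.Cruxes.GenusTwoRealPeriodCell.Disproof
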